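import Literature.Computability.Cryptography.OrderFindingPostSpec
import HarnessLib

/-!
# Shor's order-finding post-processor is polynomial time, IIIa: the model of the continued-fraction scan

Family `PQC`; towards the third `FP` stage of `orderFindingPost` (`ShorOrderFindingQuantum.lean`;
plan in `OrderFindingPostCounts.lean`, specification `OFPostCF.cfCandidate` in
`OrderFindingPostSpec.lean`): Shor's recovery of the order from a phase estimate `A/D` — "round
`c/q` to the nearest fraction having a denominator smaller than `n`; this fraction can be found in
polynomial time by using a continued fraction expansion of `c/q`" (Shor 1997, §5, p. 15 of
arXiv quant-ph/9508027v2; the quoted sentence p. 18). This file is the pure model of the clocked loop that the machine of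
`OrderFindingPostCF.lean` runs: Euclid's algorithm on `(A, D)` together with the forward recurrence
of the convergents (`OFPostCF.cfFwd`, Hardy–Wright Thm. 149) and the test `OFPostCF.cfTest` of each
new convergent.

* `euclidStep`, `quots_succ` (one more unit of fuel appends the next quotient, none once Euclid has
  stopped), `euclidStep_iterate_le`, `evalFrac_quots_le` (convergents of `A/D` have numerator
  `≤ max A 1` and denominator `≤ max D 1` — the bound that keeps the machine within its length cap);
* the loop state `CF`, `cfInit`, `cfNext`, `cfCandidate_succ`, and **`cfNext_iterate_spec`**: after
  `j` rounds the state holds Euclid's pair, `cfFwd (quots A D j)` and `cfCandidate n q A D j`.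

## References

* P. W. Shor, SIAM J. Comput. 26 (1997) 1484–1509, §5 (p. 15 of arXiv:quant-ph/9508027v2; the quoted sentence p. 18).
* G. H. Hardy, E. M. Wright, *An Introduction to the Theory of Numbers*, 6th ed. 2008, §10.2
  (Thm. 149: the recurrence of the convergents), §10.6.
-/

noncomputable section

namespace Literature.Computability.Cryptography

namespace OFPostB

open _root_.Computability OFPostCF

/-! ### Euclid's pairs and one more unit of fuel -/

/-- One step of Euclid's algorithm on a pair, idle once the second entry vanishes. [cite: HardyWright2008, §10.6] -/
def euclidStep (p : ℕ × ℕ) : ℕ × ℕ := if p.2 = 0 then p else (p.2, p.1 % p.2)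

/-- **One more unit of fuel appends the next quotient** (none once Euclid has stopped). [folklore] -/
theorem quots_succ (a b : ℕ) : ∀ j : ℕ, quots a b (j + 1) =
    quots a b j ++ (if (euclidStep^[j] (a, b)).2 = 0 then [] else [(euclidStep^[j] (a, b)).1 / (euclidStep^[j] (a, b)).2]) := by
  intro j
  induction j generalizing a b with
  | zero => by_cases hb : b = 0 <;> simp [quots, hb]
  | succ j ih =>
    by_cases hb : b = 0
    · subst hb
      have hfix : euclidStep^[j + 1] (a, 0) = (a, 0) := Function.iterate_fixed (by simp [euclidStep]) _
      simp [quots, hfix]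
    · rw [quots_succ_of_pos (Nat.pos_of_ne_zero hb), quots_succ_of_pos (Nat.pos_of_ne_zero hb), ih b (a % b),
        Function.iterate_succ_apply, show euclidStep (a, b) = (b, a % b) by simp [euclidStep, hb], List.cons_append]

/-- Euclid's pairs do not grow: both entries stay `≤ max a b`, the second `≤ b`. [folklore] -/
theorem euclidStep_iterate_le (a b : ℕ) : ∀ j : ℕ,
    (euclidStep^[j] (a, b)).1 ≤ max a b ∧ (euclidStep^[j] (a, b)).2 ≤ b ∧ (euclidStep^[j] (a, b)).2 ≤ max a b
  | 0 => by simp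
  | j + 1 => by
    obtain ⟨h1, h2, h3⟩ := euclidStep_iterate_le a b j
    rw [Function.iterate_succ_apply']
    set p := euclidStep^[j] (a, b)
    by_cases hp : p.2 = 0
    · simp only [euclidStep, hp, if_true]; omega
    · simp only [euclidStep, hp, if_false]
      have := (Nat.mod_lt p.1 (Nat.pos_of_ne_zero hp)).le
      exact ⟨h3, this.trans h2, this.trans h3⟩

/-- **Convergents of `a/b` are small**: numerator `≤ max a 1`, denominator `≤ max b 1` (for
`b > 0` the expansion is that of `a/b`; for `b = 0` it is empty, value `1/0`); by induction over
Euclid's algorithm with the back evaluation `evalFrac` (the recurrence of Hardy–Wright Thm. 149).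
[folklore] -/
theorem evalFrac_quots_le : ∀ (f a b : ℕ), (evalFrac (quots a b f)).1 ≤ max a 1 ∧ (evalFrac (quots a b f)).2 ≤ max b 1
  | 0, a, b => by simp [quots, evalFrac]
  | f + 1, a, b => by
    by_cases hb : b = 0
    · simp [quots, hb, evalFrac]
    · rw [quots_succ_of_pos (Nat.pos_of_ne_zero hb), evalFrac]
      obtain ⟨h1, h2⟩ := evalFrac_quots_le f b (a % b)
      simp only
      refine ⟨?_, h1.trans (by omega)⟩
      rw [max_eq_left (Nat.pos_of_ne_zero hb)] at h1
      by_cases hr : a % b = 0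
      · rw [hr] at h2 ⊢
        have hq : quots b 0 f = [] := by cases f <;> simp [quots]
        rw [hq, evalFrac]
        simp only [mul_one, add_zero]
        exact (Nat.div_le_self a b).trans (le_max_left _ _)
      · rw [max_eq_left (Nat.pos_of_ne_zero hr)] at h2
        have hdiv : a / b * b + a % b = a := Nat.div_add_mod' a b
        have : a / b * (evalFrac (quots b (a % b) f)).1 ≤ a / b * b := Nat.mul_le_mul_left _ h1
        calc a / b * (evalFrac (quots b (a % b) f)).1 + (evalFrac (quots b (a % b) f)).2 ≤ a / b * b + a % b := by omega
          _ = a := hdiv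
          _ ≤ max a 1 := le_max_left _ _

/-! ### The model of the loop -/

/-- The loop state: Euclid's pair `(a, b)`, the last two convergents `(p₁, q₁)`, `(p₀, q₀)` and the
result found so far (`0` = none yet; a passing denominator is positive). [folklore] -/
structure CF where
  /-- first entry of Euclid's pair -/
  a : ℕ
  /-- second entry of Euclid's pair -/
  b : ℕ
  /-- numerator of the last convergent -/
  p₁ : ℕ
  /-- denominator of the last convergent -/
  q₁ : ℕ
  /-- numerator of the previous convergent -/
  p₀ : ℕ
  /-- denominator of the previous convergent -/
  q₀ : ℕ
  /-- the first passing denominator, `0` if none so far -/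
  res : ℕ

/-- The initial state `(A, D; 1, 0; 0, 1; 0)`. [cite: HardyWright2008, §10.2 (Thm 149: p₋₁ = 1, q₋₁ = 0, p₋₂ = 0, q₋₂ = 1)] -/
def cfInit (A D : ℕ) : CF := ⟨A, D, 1, 0, 0, 1, 0⟩

/-- **One round**: idle once `b = 0`; otherwise one Euclid step, one step of the forward recurrence
with the quotient, and the test of the new convergent unless a result was already found.
[cite: Shor1997, §5 (continued fraction recovery of d/r); HardyWright2008, §10.2 Thm 149] -/
def cfNext (n q A D : ℕ) (s : CF) : CF :=
  if s.b = 0 then s else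
    { a := s.b, b := s.a % s.b,
      p₁ := s.a / s.b * s.p₁ + s.p₀, q₁ := s.a / s.b * s.q₁ + s.q₀, p₀ := s.p₁, q₀ := s.q₁,
      res := if s.res ≠ 0 then s.res
        else if cfTest n q A D (s.a / s.b * s.p₁ + s.p₀, s.a / s.b * s.q₁ + s.q₀) then s.a / s.b * s.q₁ + s.q₀ else 0 }

/-- A passing pair has a positive denominator. [folklore] -/
theorem pos_of_cfTest {n q A D : ℕ} {pq : ℕ × ℕ} (h : cfTest n q A D pq = true) : 0 < pq.2 := by
  rw [cfTest, decide_eq_true_eq] at h; exact h.1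

/-- `cfCandidate` with one more round: the earlier result, else the test of convergent `K`. [folklore] -/
theorem cfCandidate_succ (n q A D K : ℕ) : cfCandidate n q A D (K + 1) =
    if cfCandidate n q A D K ≠ 0 then cfCandidate n q A D K
    else if cfTest n q A D (evalFrac (quots A D (K + 1))) then (evalFrac (quots A D (K + 1))).2 else 0 := by
  rw [cfCandidate, cfCandidate, List.range_succ, List.find?_append]
  cases hK : (List.range K).find? fun k => cfTest n q A D (evalFrac (quots A D (k + 1))) with
  | some k =>
    have hk := List.find?_some hK
    simp only [Option.some_or]
    rw [if_pos (pos_of_cfTest hk).ne']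
  | none =>
    simp only [Option.none_or, List.find?_singleton]
    by_cases ht : cfTest n q A D (evalFrac (quots A D (K + 1))) = true
    · simp [ht]
    · simp [ht]

/-- **The model computes Euclid's pairs, the convergents and the candidate.** [cite: Shor1997, §5 (continued fraction recovery of d/r); HardyWright2008, §10.2 Thm 149] -/
theorem cfNext_iterate_spec (n q A D : ℕ) : ∀ j : ℕ,
    ((cfNext n q A D)^[j] (cfInit A D)).a = (euclidStep^[j] (A, D)).1 ∧
    ((cfNext n q A D)^[j] (cfInit A D)).b = (euclidStep^[j] (A, D)).2 ∧
    (((cfNext n q A D)^[j] (cfInit A D)).p₁, ((cfNext n q A D)^[j] (cfInit A D)).q₁,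
      ((cfNext n q A D)^[j] (cfInit A D)).p₀, ((cfNext n q A D)^[j] (cfInit A D)).q₀) = cfFwd (quots A D j) ∧
    ((cfNext n q A D)^[j] (cfInit A D)).res = cfCandidate n q A D j
  | 0 => by simp [cfInit, cfFwd, quots, cfCandidate]
  | j + 1 => by
    obtain ⟨ha, hb, hP, hres⟩ := cfNext_iterate_spec n q A D j
    set s := (cfNext n q A D)^[j] (cfInit A D) with hs
    rw [Function.iterate_succ_apply', ← hs, Function.iterate_succ_apply', cfCandidate_succ, quots_succ]
    have hfwd : ∀ l t, cfFwd (l ++ [t]) = cfStep (cfFwd l) t := fun l t => by simp [cfFwd, List.foldl_append]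
    by_cases hb0 : s.b = 0
    · -- Euclid has stopped: nothing moves; the repeated test was already made and failed
      have hstep : cfNext n q A D s = s := by simp [cfNext, hb0]
      rw [hstep, euclidStep, ← hb, if_pos hb0, if_pos hb0, List.append_nil]
      refine ⟨ha, hb, hP, ?_⟩
      rw [hres]
      by_cases hc : cfCandidate n q A D j ≠ 0
      · rw [if_pos hc]
      · rw [if_neg hc]
        push Not at hc
        rw [hc]
        cases j with
        | zero => simp [quots, evalFrac, cfTest]
        | succ j =>
          have hprev := cfCandidate_succ n q A D j
          rw [hc] at hprev
          by_cases h1 : cfCandidate n q A D j ≠ 0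
          · rw [if_pos h1] at hprev; exact absurd hprev.symm h1
          · rw [if_neg h1] at hprev
            by_cases h2 : cfTest n q A D (evalFrac (quots A D (j + 1))) = true
            · rw [if_pos h2] at hprev
              have := pos_of_cfTest h2
              omega
            · rw [if_neg h2]
    · have hb0' : ¬ (euclidStep^[j] (A, D)).2 = 0 := hb ▸ hb0
      rw [if_neg hb0', hfwd, ← hP, euclidStep, if_neg hb0', ← ha, ← hb]
      have hev : evalFrac (quots A D j ++ [s.a / s.b]) = (s.a / s.b * s.p₁ + s.p₀, s.a / s.b * s.q₁ + s.q₀) := by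
        rw [← cfFwd_eq_evalFrac, hfwd, ← hP, cfStep]
      rw [hev]
      simp only [cfNext, if_neg hb0, cfStep, hres]
      trivial


end OFPostB

end Literature.Computability.Cryptography

end
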